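import Mathlib
import HarnessLib
import Summits.NavierStokesRegularity.NavierStokesRegularity.Theorems.PoloidalWindowDoorLrcModEntireParallelWebs
import Summits.NavierStokesRegularity.NavierStokesRegularity.Theorems.PoloidalWindowDoorLrcModEntireCurvedWebHuygens

/-!
# Route `PoloidalWindowDoor`, item `LrcModEntire` (stmt-NavierStokesRegularity-20428), cells (Q4-curved)/(Q4-sonic, curved) of the (TH) column —
# HUYGENS ⇒ PARALLEL WEBS OVER A CURVED BRANCH (the weighted Grönwall step)

Cell ns-regularity-ideate, stub-worker seat ns-poloidal-K2-p2 g16 under the LEAD of item 20428 (ns-poloidal-K2-p3 g16);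
`--supports stmt-NavierStokesRegularity-20428 --as helper`.  Memo `Cruxes/LrcModEntire/T2B-g16.md` §2 (A1), `T2B-g16-sonic.md` §3 («the Fermi-frame version of
the web package is the missing brick»): the ¬line analogue of LEAD g16's `…ParallelWebs.webFun_eq_of_huygens`.

★ `webFun_eq_of_curved_huygens` — let `G` be `C²` on the open region `ℝ × (−δ₁, δ₁)` with `G(s,0) = 0`, let `k` (the curvature of the base branch) be differentiable,
and suppose the CURVED HUYGENS RELATION of `…CurvedWebHuygens.curved_huygens_identity`
`κ(z)·J²·(∂_zG)² = c(z)·(J² + (∂_sG)²)`, `J = 1 − k(s)G` (`κ > 0`, `κ, c` differentiable), holds on the region, where the Fermi factor `J` does not vanish.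
Then `G(s,z) = G(0,z)`: the web over a curved branch is the PARALLEL CURVE of the branch at a signed distance `d(z) = G(0,z)` depending on the height only.
Proof = LEAD's: the `s`-derivative of the relation, the symmetry `∂_s∂_zG = ∂_z∂_sG` and the relation itself give, for `H = ∂_sG`, `Z = ∂_zG`,
`κ J³ Z ∂_zH = c H (J ∂_sH + (k′G + kH) H)`; with `|Z| ≥ √(c/κ)` this is a linear differential inequality `|∂_zH| ≤ A|H|` on every compact vertical segment, and
`H(s,0) = 0`, so `H ≡ 0` by Grönwall (`…ParallelWebs.eq_zero_of_abs_deriv_le`).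

* `curvedParallelWebs` — the same BY NAME from the six web identities over a curved branch (`…CurvedWebHuygens.curved_huygens_identity`) for the wiring.

Class-free.  WHAT THIS IS NOT: not a claim about Navier–Stokes regularity — calculus for the hypothetical web of research cell (Q4); items 20428 / 19708 / 27893 OPEN.
-/

noncomputable section

-- the summit and its single sub-problem share the name (CONVENTIONS §1), as in every Theorems file
set_option linter.dupNamespace false

namespace Summit.NavierStokesRegularity.NavierStokesRegularity.Theorems.PoloidalWindowDoorLrcModEntireCurvedParallelWebs

open Set Function Filter Topology
open scoped InnerProductSpace RealInnerProductSpace ContDiff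
open Summit.NavierStokesRegularity.NavierStokesRegularity.Theorems.PoloidalWindowDoorLrcModEntireSheetFlattenTools
open Summit.NavierStokesRegularity.NavierStokesRegularity.Theorems.PoloidalWindowDoorLrcModEntireParallelWebsIdentity
open Summit.NavierStokesRegularity.NavierStokesRegularity.Theorems.PoloidalWindowDoorLrcModEntireParallelWebs
open Summit.NavierStokesRegularity.NavierStokesRegularity.Theorems.PoloidalWindowDoorLrcModEntireRidgeGlobalBranchFrame
open Summit.NavierStokesRegularity.NavierStokesRegularity.Theorems.PoloidalWindowDoorLrcModEntirePlanarCurveRigidity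
open Summit.NavierStokesRegularity.NavierStokesRegularity.Theorems.PoloidalWindowDoorLrcModEntireCurvedWebHuygens

/-- **CURVED HUYGENS ⇒ PARALLEL WEBS.**  See the module docstring. -/
theorem webFun_eq_of_curved_huygens {G : ℝ × ℝ → ℝ} {δ₁ : ℝ} (hδ₁ : 0 < δ₁)
    (hG : ContDiffOn ℝ 2 G (region (Ioo (-δ₁) δ₁)))
    {κ c k : ℝ → ℝ} (hκ : ∀ z ∈ Ioo (-δ₁) δ₁, 0 < κ z)
    (hκd : ∀ z ∈ Ioo (-δ₁) δ₁, DifferentiableAt ℝ κ z) (hcd : ∀ z ∈ Ioo (-δ₁) δ₁, DifferentiableAt ℝ c z)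
    (hk : Differentiable ℝ k)
    (hJ : ∀ p ∈ region (Ioo (-δ₁) δ₁), 1 - k p.1 * G p ≠ 0)
    (hrel : ∀ p ∈ region (Ioo (-δ₁) δ₁),
      κ p.2 * (1 - k p.1 * G p) ^ 2 * (fderiv ℝ G p (0, 1)) ^ 2 = c p.2 * ((1 - k p.1 * G p) ^ 2 + (fderiv ℝ G p (1, 0)) ^ 2))
    (h0 : ∀ s : ℝ, G (s, 0) = 0) :
    ∀ s : ℝ, ∀ z ∈ Ioo (-δ₁) δ₁, G (s, z) = G (0, z) := by
  set I := Ioo (-δ₁) δ₁ with hI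
  have hIo : IsOpen I := isOpen_Ioo
  have hRo : IsOpen (region I) := isOpen_region hIo
  have h0I : (0 : ℝ) ∈ I := ⟨by linarith, hδ₁⟩
  -- smoothness facts
  have hGat : ∀ p ∈ region I, ContDiffAt ℝ 2 G p := fun p hp => hG.contDiffAt (hRo.mem_nhds hp)
  have hGd : ∀ p ∈ region I, DifferentiableAt ℝ G p := fun p hp => (hGat p hp).differentiableAt (by norm_num)
  have hDG : ∀ p ∈ region I, DifferentiableAt ℝ (fderiv ℝ G) p := fun p hp =>
    ((hGat p hp).fderiv_right (m := 1) (by norm_num)).differentiableAt (by norm_num)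
  set H : ℝ × ℝ → ℝ := fun p => fderiv ℝ G p (1, 0) with hH
  set Z : ℝ × ℝ → ℝ := fun p => fderiv ℝ G p (0, 1) with hZ
  set Jf : ℝ × ℝ → ℝ := fun p => 1 - k p.1 * G p with hJf
  have hHd : ∀ p ∈ region I, DifferentiableAt ℝ H p := fun p hp => (hDG p hp).clm_apply (differentiableAt_const _)
  have hZd : ∀ p ∈ region I, DifferentiableAt ℝ Z p := fun p hp => (hDG p hp).clm_apply (differentiableAt_const _)
  have hHfd : ∀ p ∈ region I, ∀ w, fderiv ℝ H p w = fderiv ℝ (fderiv ℝ G) p w (1, 0) := fun p hp w => by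
    rw [hH, fderiv_clm_apply (hDG p hp) (differentiableAt_const _)]; simp
  have hZfd : ∀ p ∈ region I, ∀ w, fderiv ℝ Z p w = fderiv ℝ (fderiv ℝ G) p w (0, 1) := fun p hp w => by
    rw [hZ, fderiv_clm_apply (hDG p hp) (differentiableAt_const _)]; simp
  -- symmetry of the mixed partials: `∂_s Z = ∂_z H`
  have hmix : ∀ p ∈ region I, fderiv ℝ Z p (1, 0) = fderiv ℝ H p (0, 1) := fun p hp => by
    rw [hHfd p hp, hZfd p hp]
    exact (hGat p hp).isSymmSndFDerivAt (by simp) (1, 0) (0, 1)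
  -- `H` is `C¹` on the region (for the continuity of `∂_sH`)
  have hH1 : ContDiffOn ℝ 1 H (region I) := by
    have h := (hG.fderiv_of_isOpen hRo (m := 1) (by norm_num)).clm_apply contDiffOn_const (g := fun _ => ((1 : ℝ), (0 : ℝ)))
    exact h
  have hHcont : ContinuousOn (fun p => fderiv ℝ H p (1, 0)) (region I) :=
    ((hH1.fderiv_of_isOpen hRo (m := 0) (by norm_num)).continuousOn).clm_apply continuousOn_const
  have hGcont : ContinuousOn G (region I) := hG.continuousOn
  have hHc : ContinuousOn H (region I) := hH1.continuousOn
  -- the Fermi factor and its `s`-derivative `J_s = −(k′ G + k H)`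
  have hkf : ∀ p : ℝ × ℝ, HasFDerivAt (fun q : ℝ × ℝ => k q.1) ((fderiv ℝ k p.1).comp (ContinuousLinearMap.fst ℝ ℝ ℝ)) p := fun p =>
    (hk p.1).hasFDerivAt.comp p hasFDerivAt_fst
  have hJf' : ∀ p ∈ region I, HasFDerivAt Jf
      (0 - (k p.1 • fderiv ℝ G p + G p • (fderiv ℝ k p.1).comp (ContinuousLinearMap.fst ℝ ℝ ℝ))) p := fun p hp =>
    (hasFDerivAt_const (1 : ℝ) p).sub ((hkf p).mul (hGd p hp).hasFDerivAt)
  -- (T): `κ J³ Z ∂_zH = c H (J ∂_sH + (k′G + kH) H)` — the `s`-derivative of the relation, times `J`, minus `J_s ×` the relation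
  have hT : ∀ p ∈ region I, κ p.2 * Jf p ^ 3 * Z p * fderiv ℝ H p (0, 1) =
      c p.2 * H p * (Jf p * fderiv ℝ H p (1, 0) + (fderiv ℝ k p.1 1 * G p + k p.1 * H p) * H p) := by
    intro p hp
    have hκ0 : ((fderiv ℝ κ p.2).comp (ContinuousLinearMap.snd ℝ ℝ ℝ)) ((1 : ℝ), (0 : ℝ)) = 0 := by simp
    have hc0 : ((fderiv ℝ c p.2).comp (ContinuousLinearMap.snd ℝ ℝ ℝ)) ((1 : ℝ), (0 : ℝ)) = 0 := by simp
    have hΦ : ∀ q ∈ region I, (fun q : ℝ × ℝ => κ q.2 * (Jf q * Jf q * (Z q * Z q)) - c q.2 * (Jf q * Jf q + H q * H q)) q = 0 :=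
      fun q hq => by
        have := hrel q hq
        simp only [hH, hZ, hJf]
        nlinarith [this]
    have h := fderiv_eq_zero_of_eqOn_region hIo hΦ hp (1, 0)
    have hκ' : HasFDerivAt (fun q : ℝ × ℝ => κ q.2) ((fderiv ℝ κ p.2).comp (ContinuousLinearMap.snd ℝ ℝ ℝ)) p :=
      (hκd p.2 hp).hasFDerivAt.comp p hasFDerivAt_snd
    have hc' : HasFDerivAt (fun q : ℝ × ℝ => c q.2) ((fderiv ℝ c p.2).comp (ContinuousLinearMap.snd ℝ ℝ ℝ)) p :=
      (hcd p.2 hp).hasFDerivAt.comp p hasFDerivAt_snd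
    have hZ' : HasFDerivAt Z (fderiv ℝ Z p) p := (hZd p hp).hasFDerivAt
    have hH' : HasFDerivAt H (fderiv ℝ H p) p := (hHd p hp).hasFDerivAt
    have hJ' := hJf' p hp
    have hΦ' := (hκ'.mul ((hJ'.mul hJ').mul (hZ'.mul hZ'))).sub (hc'.mul ((hJ'.mul hJ').add (hH'.mul hH')))
    have hΦ'' : HasFDerivAt (fun q : ℝ × ℝ => κ q.2 * (Jf q * Jf q * (Z q * Z q)) - c q.2 * (Jf q * Jf q + H q * H q)) _ p := hΦ'
    rw [hΦ''.fderiv] at h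
    simp only [_root_.sub_apply, _root_.add_apply, _root_.neg_apply, _root_.smul_apply, smul_eq_mul, ContinuousLinearMap.coe_comp,
      Function.comp_apply, ContinuousLinearMap.coe_snd', ContinuousLinearMap.coe_fst', Pi.mul_apply, Pi.add_apply,
      map_zero, mul_zero, add_zero, zero_sub] at h
    rw [hmix p hp] at h
    have hr := hrel p hp
    -- `h`: the `s`-derivative of `Φ`; `hr`: the relation; `H p = fderiv G p (1,0)` by definition
    have hHp : fderiv ℝ G p (1, 0) = H p := rfl
    have hZp : fderiv ℝ G p (0, 1) = Z p := rfl
    rw [hHp, hZp] at hr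
    rw [hHp] at h
    change κ p.2 * Jf p ^ 2 * Z p ^ 2 = c p.2 * (Jf p ^ 2 + H p ^ 2) at hr
    linear_combination (Jf p / 2) * h + (fderiv ℝ k p.1 1 * G p + k p.1 * H p) * hr
  -- where `G_z = 0` the height is a zero of `c` and `∂_zH = 0`
  have hdeg : ∀ p ∈ region I, Z p = 0 → fderiv ℝ H p (0, 1) = 0 := by
    intro p hp hZ0
    have hc0 : c p.2 = 0 := by
      have h := hrel p hp
      rw [show fderiv ℝ G p (0, 1) = Z p from rfl, hZ0] at h
      have h1 : c p.2 * ((1 - k p.1 * G p) ^ 2 + H p ^ 2) = 0 := by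
        rw [show fderiv ℝ G p (1, 0) = H p from rfl] at h; linear_combination -h
      rcases mul_eq_zero.1 h1 with h2 | h2
      · exact h2
      · exfalso
        have hJp := hJ p hp
        have : 0 < (1 - k p.1 * G p) ^ 2 := by positivity
        nlinarith [sq_nonneg (H p)]
    -- `Z` vanishes on the whole horizontal line at this height
    have hZline : ∀ s : ℝ, Z (s, p.2) = 0 := by
      intro s
      have hq : ((s, p.2) : ℝ × ℝ) ∈ region I := hp
      have h := hrel (s, p.2) hq
      rw [hc0, zero_mul] at h
      have hJq := hJ (s, p.2) hq
      have := mul_eq_zero.1 h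
      rcases this with h1 | h1
      · rcases mul_eq_zero.1 h1 with h2 | h2
        · exact absurd h2 (hκ p.2 hp).ne'
        · exact absurd (pow_eq_zero_iff (n := 2) (by norm_num) |>.1 h2) hJq
      · exact pow_eq_zero_iff (n := 2) (by norm_num) |>.1 h1
    rw [← hmix p hp, fderiv_apply_one_zero_eq_deriv (hZd p hp)]
    have : (fun s : ℝ => Z (s, p.2)) = fun _ => 0 := funext hZline
    rw [this, deriv_const]
  -- the Grönwall bound along a vertical segment
  have hmain : ∀ (s : ℝ) (b : ℝ), 0 ≤ b → b < δ₁ → ∀ z ∈ Icc (-b) b, H (s, z) = 0 := by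
    intro s b hb hbδ
    have hKI : ∀ z ∈ Icc (-b) b, z ∈ I := fun z hz => ⟨by linarith [hz.1], by linarith [hz.2]⟩
    -- a bound `A` for `√(c/κ)·|J ∂_sH + (k′G + kH)H| / |J|³` on the segment
    obtain ⟨A, hA⟩ : ∃ A, ∀ z ∈ Icc (-b) b,
        Real.sqrt (c z / κ z) * |Jf (s, z) * fderiv ℝ H (s, z) (1, 0) + (fderiv ℝ k s 1 * G (s, z) + k s * H (s, z)) * H (s, z)| /
          |Jf (s, z)| ^ 3 ≤ A := by
      have hline : ContinuousOn (fun z : ℝ => ((s, z) : ℝ × ℝ)) (Icc (-b) b) := (continuous_const.prodMk continuous_id).continuousOn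
      have hmaps : MapsTo (fun z : ℝ => ((s, z) : ℝ × ℝ)) (Icc (-b) b) (region I) := fun z hz => hKI z hz
      have hGl : ContinuousOn (fun z => G (s, z)) (Icc (-b) b) := hGcont.comp hline hmaps
      have hHl : ContinuousOn (fun z => H (s, z)) (Icc (-b) b) := hHc.comp hline hmaps
      have hHsl : ContinuousOn (fun z => fderiv ℝ H (s, z) (1, 0)) (Icc (-b) b) := hHcont.comp hline hmaps
      have hJl : ContinuousOn (fun z => Jf (s, z)) (Icc (-b) b) := by
        simp only [hJf]; exact continuousOn_const.sub (continuousOn_const.mul hGl)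
      have hcont : ContinuousOn (fun z => Real.sqrt (c z / κ z) *
          |Jf (s, z) * fderiv ℝ H (s, z) (1, 0) + (fderiv ℝ k s 1 * G (s, z) + k s * H (s, z)) * H (s, z)| / |Jf (s, z)| ^ 3)
          (Icc (-b) b) := by
        have hcκ : ContinuousOn (fun z => c z / κ z) (Icc (-b) b) := by
          refine ContinuousOn.div ?_ ?_ fun z hz => (hκ z (hKI z hz)).ne'
          · exact fun z hz => (hcd z (hKI z hz)).continuousAt.continuousWithinAt
          · exact fun z hz => (hκd z (hKI z hz)).continuousAt.continuousWithinAt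
        refine ContinuousOn.div ((hcκ.sqrt).mul (continuous_abs.comp_continuousOn ?_)) ((continuous_abs.comp_continuousOn hJl).pow 3)
          fun z hz => ?_
        · exact (hJl.mul hHsl).add (((continuousOn_const.mul hGl).add (continuousOn_const.mul hHl)).mul hHl)
        · exact pow_ne_zero 3 (abs_ne_zero.2 (hJ (s, z) (hKI z hz)))
      obtain ⟨A, hA⟩ := (isCompact_Icc : IsCompact (Icc (-b) b)).exists_bound_of_continuousOn hcont
      exact ⟨A, fun z hz => (le_abs_self _).trans (by have h := hA z hz; rwa [Real.norm_eq_abs] at h)⟩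
    -- the differential inequality
    set h : ℝ → ℝ := fun z => H (s, z) with hh
    have hhd : ∀ z ∈ Icc (-b) b, HasDerivAt h (fderiv ℝ H (s, z) (0, 1)) z := by
      intro z hz
      have hp : ((s, z) : ℝ × ℝ) ∈ region I := hKI z hz
      have h1 : HasFDerivAt H (fderiv ℝ H (s, z)) ((fun z : ℝ => ((s, z) : ℝ × ℝ)) z) := (hHd _ hp).hasFDerivAt
      exact h1.comp_hasDerivAt z (hasDerivAt_vertical_line s z)
    have hderiv : ∀ z ∈ Icc (-b) b, deriv h z = fderiv ℝ H (s, z) (0, 1) := fun z hz => (hhd z hz).deriv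
    have hineq : ∀ z ∈ Icc (-b) b, |deriv h z| ≤ A * |h z| := by
      intro z hz
      have hzI : z ∈ I := hKI z hz
      have hp : ((s, z) : ℝ × ℝ) ∈ region I := hzI
      have hJp : Jf (s, z) ≠ 0 := hJ (s, z) hp
      have hJ3 : 0 < |Jf (s, z)| ^ 3 := pow_pos (abs_pos.2 hJp) 3
      have hA0 : 0 ≤ A := le_trans (div_nonneg (mul_nonneg (Real.sqrt_nonneg _) (abs_nonneg _)) hJ3.le) (hA z hz)
      rw [hderiv z hz]
      by_cases hZ0 : Z (s, z) = 0
      · rw [hdeg _ hp hZ0, abs_zero]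
        exact mul_nonneg hA0 (abs_nonneg _)
      · have hκz : 0 < κ z := hκ z hzI
        have hr := hrel (s, z) hp
        change κ z * Jf (s, z) ^ 2 * Z (s, z) ^ 2 = c z * (Jf (s, z) ^ 2 + H (s, z) ^ 2) at hr
        have hJ2 : 0 < Jf (s, z) ^ 2 := by positivity
        have hc0 : 0 ≤ c z := by
          have h1 : 0 ≤ c z * (Jf (s, z) ^ 2 + H (s, z) ^ 2) := by rw [← hr]; positivity
          have h2 : 0 < Jf (s, z) ^ 2 + H (s, z) ^ 2 := by nlinarith [sq_nonneg (H (s, z))]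
          exact nonneg_of_mul_nonneg_left h1 h2 |> fun h => by nlinarith [h1, h2, mul_nonneg_iff.1 h1]
        set q : ℝ := Real.sqrt (c z / κ z) with hq
        have hq0 : 0 ≤ q := Real.sqrt_nonneg _
        have hq2 : q ^ 2 = c z / κ z := Real.sq_sqrt (div_nonneg hc0 hκz.le)
        have hqZ : q ≤ |Z (s, z)| := by
          have h1 : q ^ 2 ≤ |Z (s, z)| ^ 2 := by
            rw [hq2, sq_abs, div_le_iff₀ hκz]
            -- `c ≤ κ Z²` from `κ J² Z² = c (J² + H²) ≥ c J²`
            nlinarith [sq_nonneg (H (s, z)), sq_nonneg (Z (s, z)), mul_nonneg hc0 (sq_nonneg (H (s, z)))]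
          exact (pow_le_pow_iff_left₀ hq0 (abs_nonneg _) two_ne_zero).1 h1
        have hTz := hT (s, z) hp
        set M : ℝ := Jf (s, z) * fderiv ℝ H (s, z) (1, 0) + (fderiv ℝ k s 1 * G (s, z) + k s * H (s, z)) * H (s, z) with hM
        change κ z * Jf (s, z) ^ 3 * Z (s, z) * fderiv ℝ H (s, z) (0, 1) = c z * H (s, z) * M at hTz
        -- `c ≤ κ q |Z|`
        have hcle : c z ≤ κ z * q * |Z (s, z)| := by
          have : c z = κ z * q ^ 2 := by rw [hq2]; field_simp
          rw [this]
          have := mul_le_mul_of_nonneg_left hqZ (mul_nonneg hκz.le hq0)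
          nlinarith [this]
        have habs : κ z * |Jf (s, z)| ^ 3 * |Z (s, z)| * |fderiv ℝ H (s, z) (0, 1)| = c z * |H (s, z)| * |M| := by
          have := congrArg abs hTz
          simpa [abs_mul, abs_pow, abs_of_pos hκz, abs_of_nonneg hc0, mul_assoc] using this
        have hZpos : 0 < |Z (s, z)| := abs_pos.2 hZ0
        have hprod : 0 < κ z * |Jf (s, z)| ^ 3 * |Z (s, z)| := mul_pos (mul_pos hκz hJ3) hZpos
        -- divide
        have hgoal : |fderiv ℝ H (s, z) (0, 1)| ≤ q * |M| / |Jf (s, z)| ^ 3 * |H (s, z)| := by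
          refine le_of_mul_le_mul_left ?_ hprod
          calc κ z * |Jf (s, z)| ^ 3 * |Z (s, z)| * |fderiv ℝ H (s, z) (0, 1)|
              = c z * |H (s, z)| * |M| := habs
            _ ≤ (κ z * q * |Z (s, z)|) * |H (s, z)| * |M| := by gcongr
            _ = κ z * |Jf (s, z)| ^ 3 * |Z (s, z)| * (q * |M| / |Jf (s, z)| ^ 3 * |H (s, z)|) := by
                field_simp
        calc |fderiv ℝ H (s, z) (0, 1)| ≤ q * |M| / |Jf (s, z)| ^ 3 * |H (s, z)| := hgoal
          _ ≤ A * |H (s, z)| := by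
              have := hA z hz
              exact mul_le_mul_of_nonneg_right this (abs_nonneg _)
    have hh0 : h 0 = 0 := by
      change H (s, 0) = 0
      have hp0 : ((s, (0 : ℝ)) : ℝ × ℝ) ∈ region I := h0I
      change fderiv ℝ G (s, 0) (1, 0) = 0
      rw [fderiv_apply_one_zero_eq_deriv (hGd _ hp0)]
      have : (fun s' : ℝ => G (s', ((s, (0 : ℝ)) : ℝ × ℝ).2)) = fun _ => 0 := funext fun s' => h0 s'
      rw [this, deriv_const]
    have hhd' : ∀ z ∈ Icc (-b) b, HasDerivAt h (deriv h z) z := fun z hz => by rw [hderiv z hz]; exact hhd z hz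
    exact eq_zero_of_abs_deriv_le hb hhd' hineq hh0
  -- conclusion
  intro s z hz
  set b : ℝ := (|z| + δ₁) / 2 with hb
  have hzabs : |z| < δ₁ := abs_lt.2 ⟨by linarith [hz.1], hz.2⟩
  have hb0 : 0 ≤ b := by rw [hb]; positivity
  have hbδ : b < δ₁ := by rw [hb]; linarith
  have hzb : z ∈ Icc (-b) b := by
    constructor <;> [have := neg_abs_le z; have := le_abs_self z] <;> rw [hb] <;> linarith
  -- `s ↦ G(s,z)` has zero derivative everywhere
  have hline : ∀ s' : ℝ, HasDerivAt (fun s'' : ℝ => G (s'', z)) 0 s' := by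
    intro s'
    have hp : ((s', z) : ℝ × ℝ) ∈ region I := hz
    have h1 : HasFDerivAt G (fderiv ℝ G (s', z)) ((fun s'' : ℝ => ((s'', z) : ℝ × ℝ)) s') := (hGd _ hp).hasFDerivAt
    have h2 : HasDerivAt (fun s'' : ℝ => ((s'', z) : ℝ × ℝ)) ((1 : ℝ), (0 : ℝ)) s' :=
      (hasDerivAt_id s').prodMk (hasDerivAt_const s' z)
    have h3 : HasDerivAt (fun s'' : ℝ => G (s'', z)) (fderiv ℝ G (s', z) ((1 : ℝ), (0 : ℝ))) s' := h1.comp_hasDerivAt s' h2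
    have hH0 : fderiv ℝ G (s', z) (1, 0) = 0 := hmain s' b hb0 hbδ z hzb
    rw [hH0] at h3
    exact h3
  exact is_const_of_deriv_eq_zero (fun s' => (hline s').differentiableAt) (fun s' => (hline s').deriv) s 0

/-- ★ **PARALLEL WEBS OVER A CURVED BRANCH** (BY NAME for the wiring of the curved cells).  Under the hypotheses of
`…CurvedWebHuygens.curved_huygens_identity` on the open region `ℝ × (−δ₁, δ₁)` with a `C²` web function `G`, `G(s,0) = 0`, a differentiable curvature function
`k` of the base branch, a non-vanishing Fermi factor `1 − kG`, `κ > 0`, and `κ`, `R″ − μκ` differentiable, the web function is `s`-independent: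
`G(s,z) = G(0,z)` — the web at height `z` is the parallel curve `Γ + G(0,z)·JΓ′` of the base branch. -/
theorem curvedParallelWebs {F : EuclideanSpace ℝ (Fin 3) → ℝ} (hF : ContDiff ℝ 3 F)
    {Γ : ℝ → EuclideanSpace ℝ (Fin 3)} (hΓ : ContDiff ℝ 2 Γ) (hpl : ∀ s, Γ s 2 = 0)
    {k : ℝ → ℝ} (hk : ∀ s, deriv (deriv Γ) s = k s • rotJ (deriv Γ s)) (hkd : Differentiable ℝ k)
    {δ₁ : ℝ} (hδ₁ : 0 < δ₁) {G : ℝ × ℝ → ℝ} (hG : ContDiffOn ℝ 2 G (region (Ioo (-δ₁) δ₁)))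
    {R κ μ : ℝ → ℝ} (hR : ∀ z ∈ Ioo (-δ₁) δ₁, HasDerivAt (deriv R) (deriv (deriv R) z) z)
    (hR1 : ∀ z ∈ Ioo (-δ₁) δ₁, DifferentiableAt ℝ R z)
    (hκ : ∀ z ∈ Ioo (-δ₁) δ₁, 0 < κ z) (hκd : ∀ z ∈ Ioo (-δ₁) δ₁, DifferentiableAt ℝ κ z)
    (hcd : ∀ z ∈ Ioo (-δ₁) δ₁, DifferentiableAt ℝ (fun z => deriv (deriv R) z - μ z * κ z) z)
    (hJ : ∀ p ∈ region (Ioo (-δ₁) δ₁), 1 - k p.1 * G p ≠ 0)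
    (hν : ∀ p ∈ region (Ioo (-δ₁) δ₁), fderiv ℝ F (Γ p.1 + G p • rotJ (deriv Γ p.1) + p.2 • e2) (rotJ (deriv Γ p.1)) = 0)
    (hT : ∀ p ∈ region (Ioo (-δ₁) δ₁), fderiv ℝ F (Γ p.1 + G p • rotJ (deriv Γ p.1) + p.2 • e2) (deriv Γ p.1) = 0)
    (hval : ∀ p ∈ region (Ioo (-δ₁) δ₁), F (Γ p.1 + G p • rotJ (deriv Γ p.1) + p.2 • e2) = R p.2)
    (hridge : ∀ p ∈ region (Ioo (-δ₁) δ₁),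
      fderiv ℝ (fderiv ℝ F) (Γ p.1 + G p • rotJ (deriv Γ p.1) + p.2 • e2) (deriv Γ p.1) (deriv Γ p.1) +
        fderiv ℝ (fderiv ℝ F) (Γ p.1 + G p • rotJ (deriv Γ p.1) + p.2 • e2) (rotJ (deriv Γ p.1)) (rotJ (deriv Γ p.1)) = -κ p.2)
    (hslice : ∀ p ∈ region (Ioo (-δ₁) δ₁),
      fderiv ℝ (fderiv ℝ F) (Γ p.1 + G p • rotJ (deriv Γ p.1) + p.2 • e2) e2 e2 =
        -μ p.2 * (fderiv ℝ (fderiv ℝ F) (Γ p.1 + G p • rotJ (deriv Γ p.1) + p.2 • e2) (deriv Γ p.1) (deriv Γ p.1) +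
          fderiv ℝ (fderiv ℝ F) (Γ p.1 + G p • rotJ (deriv Γ p.1) + p.2 • e2) (rotJ (deriv Γ p.1)) (rotJ (deriv Γ p.1))))
    (h0 : ∀ s : ℝ, G (s, 0) = 0) :
    ∀ s : ℝ, ∀ z ∈ Ioo (-δ₁) δ₁, G (s, z) = G (0, z) := by
  have hGd : ∀ p ∈ region (Ioo (-δ₁) δ₁), DifferentiableAt ℝ G p := fun p hp =>
    (hG.contDiffAt ((isOpen_region isOpen_Ioo).mem_nhds hp)).differentiableAt (by norm_num)
  have hrel : ∀ p ∈ region (Ioo (-δ₁) δ₁), κ p.2 * (1 - k p.1 * G p) ^ 2 * (fderiv ℝ G p (0, 1)) ^ 2 =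
      (fun z => deriv (deriv R) z - μ z * κ z) p.2 * ((1 - k p.1 * G p) ^ 2 + (fderiv ℝ G p (1, 0)) ^ 2) := fun p hp =>
    curved_huygens_identity hF hΓ hpl hk isOpen_Ioo hGd hR hR1 hν hT hval hridge hslice hp
  exact webFun_eq_of_curved_huygens hδ₁ hG hκ hκd hcd hkd hJ hrel h0

end Summit.NavierStokesRegularity.NavierStokesRegularity.Theorems.PoloidalWindowDoorLrcModEntireCurvedParallelWebs
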